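import Mathlib
import Literature.ComputerArithmetic.BrisebarreHanrotMullerZimmermann2025.TableMakersDilemma
import HarnessLib

/-!
# Exact cases of the standard binary64 functions at rational (hence floating-point) arguments

Companion to `TableMakersDilemma.lean` (same source and vocabulary). Brisebarre–Hanrot–Muller–Zimmermann,
ACM CSUR 2025 [BrisebarreEtAl2025], §4.3.3: "Addressing the question of worst cases from a theoretical point of
view requires: (1) the determination of all FP numbers x in precision p such that f(x) is a breakpoint; (2) for
the remaining FP numbers … proving a lower bound". §4.1: Ziv's strategy "requires … the knowledge that there are
no nontrivial exact cases …, which is known to be true for the exponential, logarithmic and trigonometric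
functions thanks to Hermite-Lindemann's theorem"; Table 2 of the survey reduces the bad/exact cases of `sin`,
`cos`, `tan`, `sinh`, `cosh`, `tanh` (and, through Lemma 4.8, of their inverses) to those of `exp`. Lefèvre–Muller
ARITH-15 (2001) [LefevreMuller2001]: Table 4 "Integer values of x are omitted" (for `2^x`), Table 5 "Values of
x that are integer powers of 2 are omitted" (for `log2`), §1 footnote 2 (for `ln`, `1` is the only exact
argument). Lefèvre–Ly–Zimmermann (ARITH 2026), Lemma 2: "sin x cannot be exact for any non-zero floating-point
number x". The CORE-MATH worst-case files list the exact arguments of each function in a separate section; the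
theorems below say that, apart from those listed trivial arguments, there are none — for ANY precision and ANY
rounding mode, since a breakpoint of the scaled value is a rational number (an integer or a half-integer,
`IsExactCaseDir` / `IsExactCaseRN`) and the scaled value `c · f(q)` (`c ∈ ℚ`, `c ≠ 0`) is irrational.

`TableMakersDilemma.lean` proved this for `exp`, `log`, `sin`, `cos` (from the tree's Hermite–Lindemann and
Lindemann–Weierstrass theorems). This file derives, by elementary algebra from those four transcendence
results, the remaining functions of the C99/C23 univariate list that have this property:

* `tan q` (`q ≠ 0`), `arctan x` (`x ≠ 0`), `arcsin x` (`0 < |x| ≤ 1`), `arccos x` (`−1 ≤ x < 1`);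
* `sinh q`, `cosh q`, `tanh q` (`q ≠ 0`), `arsinh x` (`x ≠ 0`), `arcosh x` (`x > 1`), `artanh x` (`0 < |x| < 1`);
* `exp q − 1` (`q ≠ 0`), `log (1 + x)` (`x > −1`, `x ≠ 0`);
* `2^q` and `10^q` for rational NON-INTEGER `q`, `log₂ x` for positive rational `x` not an integer power of `2`,
  `log₁₀ x` for positive rational `x` not an integer power of `10` (a `2`-adic valuation argument:
  `N^(a/b) ∈ ℚ` with `v₂(N) = 1` forces `b ∣ a`).

Everything is PROVED; no named facts. Not covered (exact cases are NOT rare there, or the function is not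
elementary): `pow`, `hypot`, `atan2` (bivariate; see Lauter–Lefèvre 2009 for `pow`), `cbrt`, `rsqrt`, `sqrt`
(algebraic: exact cases are the perfect powers), `erf`, `erfc`, `lgamma`, `tgamma`, and the `…pi` functions
(`sinpi` etc. have many exact cases at dyadic arguments).
-/

namespace Literature.ComputerArithmetic.BrisebarreHanrotMullerZimmermann2025

open Real

/-! ## From irrationality to "no exact case" -/

/-- A breakpoint of the scaled grid is rational (an integer for the directed roundings, a half-integer for
round-to-nearest, BHMZ Definition 2.4), so an irrational scaled value is never an exact case.
[cite: BrisebarreEtAl2025, Definition 2.4 and §4.3.3] -/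
theorem no_exact_case_of_irrational {y : ℝ} (h : Irrational y) :
    ¬ IsExactCaseDir y ∧ ¬ IsExactCaseRN y := by
  refine ⟨?_, ?_⟩
  · rintro ⟨k, hk⟩
    exact h.ne_int k hk
  · rintro ⟨k, hk⟩
    have : y = ((k + 1 / 2 : ℚ) : ℝ) := by rw [hk]; push_cast; ring
    exact h.ne_rat _ this

/-- Scaled form: for rational `c ≠ 0` (the scaling `2^(p−1−e₂)` of Problems 4.1/4.2 is such a `c`) and an
irrational value `y`, `c · y` is no exact case, in any precision and for any rounding mode.
[cite: BrisebarreEtAl2025, §4.3.1 and §4.3.3] -/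
theorem no_exact_case_ratCast_mul {c : ℚ} (hc : c ≠ 0) {y : ℝ} (h : Irrational y) :
    ¬ IsExactCaseDir ((c : ℝ) * y) ∧ ¬ IsExactCaseRN ((c : ℝ) * y) :=
  no_exact_case_of_irrational (h.ratCast_mul hc)

/-- A rational real number is algebraic over `ℚ`. [folklore] -/
private theorem isAlgebraic_ratCast (r : ℚ) : IsAlgebraic ℚ (r : ℝ) := by
  simpa using isAlgebraic_algebraMap (R := ℚ) (A := ℝ) r

/-- A transcendental real number is not equal to a rational. [folklore] -/
private theorem Transcendental.ne_ratCast {y : ℝ} (h : Transcendental ℚ y) (r : ℚ) : y ≠ r := by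
  rintro rfl; exact h (isAlgebraic_ratCast r)

/-! ## Trigonometric functions and their inverses (BHMZ Table 2, rows `sin`/`cos`/`tan`; Lemma 4.8) -/

/-- For a nonzero rational `q`, `tan q` is irrational. Proof: if `tan q = r ∈ ℚ` then `cos q ≠ 0`
(`cos q` is transcendental) and `sin q = r cos q`, so `(1 + r²) cos² q = 1` and `cos q` would be algebraic.
[cite: BrisebarreEtAl2025, §4.1 and Table 2] -/
theorem irrational_tan_ratCast {q : ℚ} (hq : q ≠ 0) : Irrational (Real.tan q) := by
  rintro ⟨r, hr⟩
  have hcosT := transcendental_cos_ratCast hq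
  have hcos : Real.cos q ≠ 0 := fun h0 => hcosT (by rw [h0]; exact isAlgebraic_zero)
  have hsin : Real.sin q = r * Real.cos q := by
    have h := hr
    rw [Real.tan_eq_sin_div_cos, eq_div_iff hcos] at h
    exact h.symm
  have hsq : Real.cos q ^ 2 = (((1 + r ^ 2)⁻¹ : ℚ) : ℝ) := by
    have h1 : Real.sin q ^ 2 + Real.cos q ^ 2 = 1 := Real.sin_sq_add_cos_sq q
    rw [hsin] at h1
    have hpos : (0 : ℝ) < 1 + (r : ℝ) ^ 2 := by positivity
    push_cast
    field_simp
    nlinarith [h1]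
  exact hcosT (IsAlgebraic.of_pow two_pos (by rw [hsq]; exact isAlgebraic_ratCast _))

/-- **`tan` has no exact case at a nonzero rational argument** (any precision, any rounding mode).
[cite: BrisebarreEtAl2025, §4.1 and Table 2] -/
theorem tan_no_exact_case {c q : ℚ} (hc : c ≠ 0) (hq : q ≠ 0) :
    ¬ IsExactCaseDir ((c : ℝ) * Real.tan q) ∧ ¬ IsExactCaseRN ((c : ℝ) * Real.tan q) :=
  no_exact_case_ratCast_mul hc (irrational_tan_ratCast hq)

/-- For a nonzero rational `x`, `arctan x` is irrational (if `arctan x = r ∈ ℚ` then `r ≠ 0` and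
`tan r = x ∈ ℚ`). BHMZ Lemma 4.8 (bad/exact cases of an inverse function are those of the function).
[cite: BrisebarreEtAl2025, Lemma 4.8 and Table 2] -/
theorem irrational_arctan_ratCast {x : ℚ} (hx : x ≠ 0) : Irrational (Real.arctan x) := by
  rintro ⟨r, hr⟩
  have htan : Real.tan r = x := by rw [hr, Real.tan_arctan]
  have hr0 : r ≠ 0 := by
    rintro rfl
    apply hx
    have : (x : ℝ) = 0 := by rw [← htan]; simp
    exact_mod_cast this
  exact irrational_tan_ratCast hr0 ⟨x, htan.symm⟩

/-- **`atan` has no exact case at a nonzero rational argument.** [cite: BrisebarreEtAl2025, Lemma 4.8 and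
Table 2] -/
theorem arctan_no_exact_case {c x : ℚ} (hc : c ≠ 0) (hx : x ≠ 0) :
    ¬ IsExactCaseDir ((c : ℝ) * Real.arctan x) ∧ ¬ IsExactCaseRN ((c : ℝ) * Real.arctan x) :=
  no_exact_case_ratCast_mul hc (irrational_arctan_ratCast hx)

/-- For a rational `x` with `0 < |x| ≤ 1` (the domain of `asin`; written `−1 ≤ x ≤ 1`, `x ≠ 0`), `arcsin x`
is irrational (else `sin r = x` for a nonzero rational `r`). [cite: BrisebarreEtAl2025, Lemma 4.8 and
Table 2] -/
theorem irrational_arcsin_ratCast {x : ℚ} (hx : x ≠ 0) (hx1 : -1 ≤ x) (hx2 : x ≤ 1) :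
    Irrational (Real.arcsin x) := by
  rintro ⟨r, hr⟩
  have hsin : Real.sin r = x := by
    rw [hr, Real.sin_arcsin (by exact_mod_cast hx1) (by exact_mod_cast hx2)]
  have hr0 : r ≠ 0 := by
    rintro rfl
    apply hx
    have : (x : ℝ) = 0 := by rw [← hsin]; simp
    exact_mod_cast this
  exact Transcendental.ne_ratCast (transcendental_sin_ratCast hr0) x hsin

/-- **`asin` has no exact case at a rational argument `x ≠ 0` of its domain.**
[cite: BrisebarreEtAl2025, Lemma 4.8 and Table 2] -/
theorem arcsin_no_exact_case {c x : ℚ} (hc : c ≠ 0) (hx : x ≠ 0) (hx1 : -1 ≤ x) (hx2 : x ≤ 1) :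
    ¬ IsExactCaseDir ((c : ℝ) * Real.arcsin x) ∧ ¬ IsExactCaseRN ((c : ℝ) * Real.arcsin x) :=
  no_exact_case_ratCast_mul hc (irrational_arcsin_ratCast hx hx1 hx2)

/-- For a rational `x` with `−1 ≤ x < 1` (the domain of `acos` minus its one exact argument `1`, where
`acos 1 = 0`), `arccos x` is irrational. [cite: BrisebarreEtAl2025, Lemma 4.8 and Table 2] -/
theorem irrational_arccos_ratCast {x : ℚ} (hx1 : -1 ≤ x) (hx2 : x < 1) :
    Irrational (Real.arccos x) := by
  rintro ⟨r, hr⟩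
  have hcos : Real.cos r = x := by
    rw [hr, Real.cos_arccos (by exact_mod_cast hx1) (by exact_mod_cast hx2.le)]
  have hr0 : r ≠ 0 := by
    rintro rfl
    have h0 : Real.arccos x = 0 := by exact_mod_cast hr.symm
    rw [Real.arccos_eq_zero] at h0
    exact absurd (by exact_mod_cast h0 : (1 : ℚ) ≤ x) (not_le.mpr hx2)
  exact Transcendental.ne_ratCast (transcendental_cos_ratCast hr0) x hcos

/-- **`acos` has no exact case at a rational argument `x ≠ 1` of its domain.**
[cite: BrisebarreEtAl2025, Lemma 4.8 and Table 2] -/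
theorem arccos_no_exact_case {c x : ℚ} (hc : c ≠ 0) (hx1 : -1 ≤ x) (hx2 : x < 1) :
    ¬ IsExactCaseDir ((c : ℝ) * Real.arccos x) ∧ ¬ IsExactCaseRN ((c : ℝ) * Real.arccos x) :=
  no_exact_case_ratCast_mul hc (irrational_arccos_ratCast hx1 hx2)

/-! ## Hyperbolic functions and their inverses (BHMZ Table 2, rows `sinh`/`cosh`/`tanh`; Lemma 4.8) -/

/-- If `sinh q` and `cosh q` are both algebraic then so is `exp q = cosh q + sinh q`; hence for a nonzero
rational `q` they cannot both be algebraic (Hermite–Lindemann). [cite: BrisebarreEtAl2025, Table 2] -/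
private theorem not_isAlgebraic_cosh_and_sinh {q : ℚ} (hq : q ≠ 0) (hc : IsAlgebraic ℚ (Real.cosh q))
    (hs : IsAlgebraic ℚ (Real.sinh q)) : False := by
  have : IsAlgebraic ℚ (Real.exp q) := by rw [← Real.cosh_add_sinh]; exact hc.add hs
  exact transcendental_exp_ratCast hq this

/-- For a nonzero rational `q`, `sinh q` is irrational (`cosh² q = sinh² q + 1` would make `cosh q`, hence
`exp q`, algebraic). [cite: BrisebarreEtAl2025, §4.1 and Table 2] -/
theorem irrational_sinh_ratCast {q : ℚ} (hq : q ≠ 0) : Irrational (Real.sinh q) := by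
  rintro ⟨r, hr⟩
  refine not_isAlgebraic_cosh_and_sinh hq (IsAlgebraic.of_pow two_pos ?_) (by rw [← hr]; exact isAlgebraic_ratCast r)
  rw [Real.cosh_sq, ← hr, show (r : ℝ) ^ 2 + 1 = ((r ^ 2 + 1 : ℚ) : ℝ) by push_cast; ring]
  exact isAlgebraic_ratCast _

/-- **`sinh` has no exact case at a nonzero rational argument.** [cite: BrisebarreEtAl2025, Table 2] -/
theorem sinh_no_exact_case {c q : ℚ} (hc : c ≠ 0) (hq : q ≠ 0) :
    ¬ IsExactCaseDir ((c : ℝ) * Real.sinh q) ∧ ¬ IsExactCaseRN ((c : ℝ) * Real.sinh q) :=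
  no_exact_case_ratCast_mul hc (irrational_sinh_ratCast hq)

/-- For a nonzero rational `q`, `cosh q` is irrational (`sinh² q = cosh² q − 1`). [cite: BrisebarreEtAl2025,
§4.1 and Table 2] -/
theorem irrational_cosh_ratCast {q : ℚ} (hq : q ≠ 0) : Irrational (Real.cosh q) := by
  rintro ⟨r, hr⟩
  refine not_isAlgebraic_cosh_and_sinh hq (by rw [← hr]; exact isAlgebraic_ratCast r) (IsAlgebraic.of_pow two_pos ?_)
  rw [Real.sinh_sq, ← hr, show (r : ℝ) ^ 2 - 1 = ((r ^ 2 - 1 : ℚ) : ℝ) by push_cast; ring]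
  exact isAlgebraic_ratCast _

/-- **`cosh` has no exact case at a nonzero rational argument** (its one exact argument is `0`, `cosh 0 = 1`).
[cite: BrisebarreEtAl2025, Table 2] -/
theorem cosh_no_exact_case {c q : ℚ} (hc : c ≠ 0) (hq : q ≠ 0) :
    ¬ IsExactCaseDir ((c : ℝ) * Real.cosh q) ∧ ¬ IsExactCaseRN ((c : ℝ) * Real.cosh q) :=
  no_exact_case_ratCast_mul hc (irrational_cosh_ratCast hq)

/-- For a nonzero rational `q`, `tanh q` is irrational: `tanh q = t ∈ ℚ` gives `sinh q = t cosh q` and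
`(1 − t²) cosh² q = 1`, making `cosh q` and `sinh q` algebraic. [cite: BrisebarreEtAl2025, §4.1 and Table 2] -/
theorem irrational_tanh_ratCast {q : ℚ} (hq : q ≠ 0) : Irrational (Real.tanh q) := by
  rintro ⟨t, ht⟩
  have hcosh : Real.cosh q ≠ 0 := (Real.cosh_pos _).ne'
  have hsinh : Real.sinh q = t * Real.cosh q := by
    have h := ht
    rw [Real.tanh_eq_sinh_div_cosh, eq_div_iff hcosh] at h
    exact h.symm
  have h1 : Real.cosh q ^ 2 = Real.sinh q ^ 2 + 1 := Real.cosh_sq q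
  rw [hsinh] at h1
  have ht1 : (1 : ℝ) - (t : ℝ) ^ 2 ≠ 0 := by
    intro h0
    have : Real.cosh q ^ 2 * (1 - (t : ℝ) ^ 2) = 1 := by nlinarith [h1]
    rw [h0, mul_zero] at this
    exact zero_ne_one this
  have hsq : Real.cosh q ^ 2 = (((1 - t ^ 2)⁻¹ : ℚ) : ℝ) := by
    push_cast
    field_simp
    nlinarith [h1]
  have hc : IsAlgebraic ℚ (Real.cosh q) :=
    IsAlgebraic.of_pow two_pos (by rw [hsq]; exact isAlgebraic_ratCast _)
  exact not_isAlgebraic_cosh_and_sinh hq hc (by rw [hsinh]; exact (isAlgebraic_ratCast t).mul hc)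

/-- **`tanh` has no exact case at a nonzero rational argument.** [cite: BrisebarreEtAl2025, Table 2] -/
theorem tanh_no_exact_case {c q : ℚ} (hc : c ≠ 0) (hq : q ≠ 0) :
    ¬ IsExactCaseDir ((c : ℝ) * Real.tanh q) ∧ ¬ IsExactCaseRN ((c : ℝ) * Real.tanh q) :=
  no_exact_case_ratCast_mul hc (irrational_tanh_ratCast hq)

/-- For a nonzero rational `x`, `arsinh x` is irrational (else `sinh r = x` with `r ∈ ℚ`, `r ≠ 0`).
[cite: BrisebarreEtAl2025, Lemma 4.8 and Table 2] -/
theorem irrational_arsinh_ratCast {x : ℚ} (hx : x ≠ 0) : Irrational (Real.arsinh x) := by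
  rintro ⟨r, hr⟩
  have hs : Real.sinh r = x := by rw [hr, Real.sinh_arsinh]
  have hr0 : r ≠ 0 := by
    rintro rfl
    apply hx
    have : (x : ℝ) = 0 := by rw [← hs]; simp
    exact_mod_cast this
  exact irrational_sinh_ratCast hr0 ⟨x, hs.symm⟩

/-- **`asinh` has no exact case at a nonzero rational argument.** [cite: BrisebarreEtAl2025, Lemma 4.8 and
Table 2] -/
theorem arsinh_no_exact_case {c x : ℚ} (hc : c ≠ 0) (hx : x ≠ 0) :
    ¬ IsExactCaseDir ((c : ℝ) * Real.arsinh x) ∧ ¬ IsExactCaseRN ((c : ℝ) * Real.arsinh x) :=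
  no_exact_case_ratCast_mul hc (irrational_arsinh_ratCast hx)

/-- For a rational `x > 1` (the domain of `acosh` minus its exact argument `1`, `acosh 1 = 0`), `arcosh x` is
irrational. [cite: BrisebarreEtAl2025, Lemma 4.8 and Table 2] -/
theorem irrational_arcosh_ratCast {x : ℚ} (hx : 1 < x) : Irrational (Real.arcosh x) := by
  rintro ⟨r, hr⟩
  have hx1 : (1 : ℝ) ≤ x := by exact_mod_cast hx.le
  have hc : Real.cosh r = x := by rw [hr, Real.cosh_arcosh hx1]
  have hr0 : r ≠ 0 := by
    rintro rfl
    have h0 : Real.arcosh x = 0 := by exact_mod_cast hr.symm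
    rw [Real.arcosh_eq_zero_iff hx1] at h0
    exact absurd (by exact_mod_cast h0 : x = 1) hx.ne'
  exact irrational_cosh_ratCast hr0 ⟨x, hc.symm⟩

/-- **`acosh` has no exact case at a rational argument `x > 1`.** [cite: BrisebarreEtAl2025, Lemma 4.8 and
Table 2] -/
theorem arcosh_no_exact_case {c x : ℚ} (hc : c ≠ 0) (hx : 1 < x) :
    ¬ IsExactCaseDir ((c : ℝ) * Real.arcosh x) ∧ ¬ IsExactCaseRN ((c : ℝ) * Real.arcosh x) :=
  no_exact_case_ratCast_mul hc (irrational_arcosh_ratCast hx)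

/-- For a rational `x` with `0 < |x| < 1` (the domain of `atanh` minus its exact argument `0`), `artanh x` is
irrational. [cite: BrisebarreEtAl2025, Lemma 4.8 and Table 2] -/
theorem irrational_artanh_ratCast {x : ℚ} (hx : x ≠ 0) (hx1 : -1 < x) (hx2 : x < 1) :
    Irrational (Real.artanh x) := by
  rintro ⟨r, hr⟩
  have hmem : (x : ℝ) ∈ Set.Ioo (-1 : ℝ) 1 := ⟨by exact_mod_cast hx1, by exact_mod_cast hx2⟩
  have ht : Real.tanh r = x := by rw [hr, Real.tanh_artanh hmem]
  have hr0 : r ≠ 0 := by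
    rintro rfl
    have h0 : Real.artanh x = 0 := by exact_mod_cast hr.symm
    rw [Real.artanh_eq_zero_iff] at h0
    rcases h0 with h | h | h
    · exact absurd (by exact_mod_cast h : x ≤ -1) (not_le.mpr hx1)
    · exact hx (by exact_mod_cast h)
    · exact absurd (by exact_mod_cast h : (1 : ℚ) ≤ x) (not_le.mpr hx2)
  exact irrational_tanh_ratCast hr0 ⟨x, ht.symm⟩

/-- **`atanh` has no exact case at a rational argument `x ≠ 0` of its domain.**
[cite: BrisebarreEtAl2025, Lemma 4.8 and Table 2] -/
theorem artanh_no_exact_case {c x : ℚ} (hc : c ≠ 0) (hx : x ≠ 0) (hx1 : -1 < x) (hx2 : x < 1) :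
    ¬ IsExactCaseDir ((c : ℝ) * Real.artanh x) ∧ ¬ IsExactCaseRN ((c : ℝ) * Real.artanh x) :=
  no_exact_case_ratCast_mul hc (irrational_artanh_ratCast hx hx1 hx2)

/-! ## `expm1` and `log1p` -/

/-- For a nonzero rational `q`, `exp q − 1` is irrational. [cite: BrisebarreEtAl2025, §4.3.3] -/
theorem irrational_expm1_ratCast {q : ℚ} (hq : q ≠ 0) : Irrational (Real.exp q - 1) := by
  rintro ⟨r, hr⟩
  exact irrational_exp_ratCast hq ⟨r + 1, by push_cast; linarith⟩

/-- **`expm1` has no exact case at a nonzero rational argument.** [cite: BrisebarreEtAl2025, §4.3.3] -/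
theorem expm1_no_exact_case {c q : ℚ} (hc : c ≠ 0) (hq : q ≠ 0) :
    ¬ IsExactCaseDir ((c : ℝ) * (Real.exp q - 1)) ∧ ¬ IsExactCaseRN ((c : ℝ) * (Real.exp q - 1)) :=
  no_exact_case_ratCast_mul hc (irrational_expm1_ratCast hq)

/-- For a rational `x > −1`, `x ≠ 0`, `log (1 + x)` is irrational. [cite: LefevreMuller2001, §1 footnote 2] -/
theorem irrational_log1p_ratCast {x : ℚ} (hx : -1 < x) (hx0 : x ≠ 0) : Irrational (Real.log (1 + x)) := by
  have h := irrational_log_ratCast (x := 1 + x) (by linarith) (by intro h; apply hx0; linarith)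
  simpa using h

/-- **`log1p` has no exact case at a rational argument `x > −1`, `x ≠ 0`.** [cite: LefevreMuller2001, §1
footnote 2] -/
theorem log1p_no_exact_case {c x : ℚ} (hc : c ≠ 0) (hx : -1 < x) (hx0 : x ≠ 0) :
    ¬ IsExactCaseDir ((c : ℝ) * Real.log (1 + x)) ∧ ¬ IsExactCaseRN ((c : ℝ) * Real.log (1 + x)) :=
  no_exact_case_ratCast_mul hc (irrational_log1p_ratCast hx hx0)

/-! ## `exp2`, `exp10`, `log2`, `log10`: a 2-adic valuation argument -/

/-- If `N` is a natural number with `v₂(N) = 1` (e.g. `2`, `10`) and the real power `N^(a/b)` (`a ∈ ℤ`,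
`b ≥ 1`) is a rational number `r`, then `b ∣ a`: indeed `r^b = N^a`, and comparing 2-adic valuations gives
`b · v₂(r) = a`. [cite: LefevreMuller2001, §5 (Tables 4–5: integer arguments of 2^x / powers of 2 for log2
are the omitted exact cases)] -/
theorem dvd_of_rpow_eq_ratCast {N : ℕ} (hN : padicValRat 2 (N : ℚ) = 1) {a : ℤ} {b : ℕ} (hb : 0 < b)
    {r : ℚ} (h : (N : ℝ) ^ ((a : ℝ) / b) = r) : (b : ℤ) ∣ a := by
  have hN0 : N ≠ 0 := by rintro rfl; simp at hN
  have hNpos : (0 : ℝ) < N := by exact_mod_cast Nat.pos_of_ne_zero hN0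
  -- `r ^ b = N ^ a` in `ℝ`, then in `ℚ`
  have hpow : ((r ^ b : ℚ) : ℝ) = (((N : ℚ) ^ a : ℚ) : ℝ) := by
    push_cast
    rw [← h, ← Real.rpow_mul_natCast hNpos.le, div_mul_cancel₀ _ (by exact_mod_cast hb.ne'),
      Real.rpow_intCast]
  have hq : r ^ b = (N : ℚ) ^ a := by exact_mod_cast hpow
  have hv := congrArg (padicValRat 2) hq
  rw [padicValRat.pow, padicValRat.zpow, hN, mul_one] at hv
  exact ⟨padicValRat 2 r, by rw [← hv]⟩

/-- For `N` with `v₂(N) = 1` and a rational `q` that is NOT an integer, `N^q` is irrational.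
[cite: LefevreMuller2001, §5.1 and Table 4] -/
theorem irrational_rpow_ratCast {N : ℕ} (hN : padicValRat 2 (N : ℚ) = 1) {q : ℚ}
    (hq : ∀ n : ℤ, q ≠ n) : Irrational ((N : ℝ) ^ (q : ℝ)) := by
  rintro ⟨r, hr⟩
  have hcast : (q : ℝ) = (q.num : ℝ) / (q.den : ℕ) := by
    rw [← Rat.num_div_den q]; push_cast; rw [Rat.num_div_den q]
  rw [hcast] at hr
  have hdvd : (q.den : ℤ) ∣ q.num := dvd_of_rpow_eq_ratCast hN q.den_pos hr.symm
  have hden : q.den = 1 :=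
    Nat.Coprime.eq_one_of_dvd q.reduced.symm (Int.natCast_dvd.mp hdvd)
  exact hq q.num (Rat.coe_int_num_of_den_eq_one hden).symm

/-- `v₂(2) = 1`. [folklore] -/
private theorem padicValRat_two_two : padicValRat 2 ((2 : ℕ) : ℚ) = 1 := by
  simpa using padicValRat.self (p := 2) one_lt_two

/-- `v₂(10) = 1`. [folklore] -/
private theorem padicValRat_two_ten : padicValRat 2 ((10 : ℕ) : ℚ) = 1 := by
  have h10 : ((10 : ℕ) : ℚ) = 2 * 5 := by norm_num
  rw [h10, padicValRat.mul (by norm_num) (by norm_num)]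
  have h5 : padicValRat 2 (5 : ℚ) = 0 := by
    have : padicValRat 2 ((5 : ℕ) : ℚ) = 0 := by
      rw [← padicValRat_of_nat]
      simp [padicValNat.eq_zero_of_not_dvd (by norm_num : ¬ 2 ∣ 5)]
    simpa using this
  have h2 : padicValRat 2 (2 : ℚ) = 1 := by simpa using padicValRat_two_two
  rw [h2, h5]; norm_num

/-- **`2^q` is irrational for every rational non-integer `q`**; in particular `exp2` has no exact case at
a non-integer floating-point argument (Lefèvre–Muller, Table 4: "Integer values of x are omitted").
[cite: LefevreMuller2001, §5.1 and Table 4] -/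
theorem irrational_two_rpow_ratCast {q : ℚ} (hq : ∀ n : ℤ, q ≠ n) : Irrational ((2 : ℝ) ^ (q : ℝ)) := by
  simpa using irrational_rpow_ratCast padicValRat_two_two hq

/-- **`exp2` has no exact case at a rational non-integer argument.** [cite: LefevreMuller2001, Table 4] -/
theorem exp2_no_exact_case {c q : ℚ} (hc : c ≠ 0) (hq : ∀ n : ℤ, q ≠ n) :
    ¬ IsExactCaseDir ((c : ℝ) * (2 : ℝ) ^ (q : ℝ)) ∧ ¬ IsExactCaseRN ((c : ℝ) * (2 : ℝ) ^ (q : ℝ)) :=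
  no_exact_case_ratCast_mul hc (irrational_two_rpow_ratCast hq)

/-- **`10^q` is irrational for every rational non-integer `q`** (`v₂(10) = 1`); `exp10` has no exact case at
a non-integer floating-point argument. [cite: LefevreMuller2001, §5.1 (radix-10 analogue of Table 4)] -/
theorem irrational_ten_rpow_ratCast {q : ℚ} (hq : ∀ n : ℤ, q ≠ n) : Irrational ((10 : ℝ) ^ (q : ℝ)) := by
  simpa using irrational_rpow_ratCast padicValRat_two_ten hq

/-- **`exp10` has no exact case at a rational non-integer argument.** [cite: LefevreMuller2001, §5.1] -/
theorem exp10_no_exact_case {c q : ℚ} (hc : c ≠ 0) (hq : ∀ n : ℤ, q ≠ n) :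
    ¬ IsExactCaseDir ((c : ℝ) * (10 : ℝ) ^ (q : ℝ)) ∧ ¬ IsExactCaseRN ((c : ℝ) * (10 : ℝ) ^ (q : ℝ)) :=
  no_exact_case_ratCast_mul hc (irrational_ten_rpow_ratCast hq)

/-- For `N` with `v₂(N) = 1`, `N > 1`, and a positive rational `x` that is not an INTEGER power of `N`,
`log_N x` is irrational: if `log_N x = r ∈ ℚ` then `N^r = x ∈ ℚ`, so `r` is an integer `k` and `x = N^k`.
[cite: LefevreMuller2001, §5.2 and Table 5] -/
theorem irrational_logb_ratCast {N : ℕ} (hN : padicValRat 2 (N : ℚ) = 1) (hN1 : 1 < N) {x : ℚ}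
    (hx : 0 < x) (hxpow : ∀ k : ℤ, x ≠ (N : ℚ) ^ k) : Irrational (Real.logb N x) := by
  rintro ⟨r, hr⟩
  have hNpos : (0 : ℝ) < N := by exact_mod_cast (zero_lt_one.trans hN1)
  have hNne : (N : ℝ) ≠ 1 := by exact_mod_cast hN1.ne'
  have hpow : (N : ℝ) ^ (r : ℝ) = x := by rw [hr, Real.rpow_logb hNpos hNne (by exact_mod_cast hx)]
  by_cases hint : ∃ n : ℤ, r = n
  · obtain ⟨n, rfl⟩ := hint
    apply hxpow n
    have : (((N : ℚ) ^ n : ℚ) : ℝ) = x := by push_cast; rw [← hpow]; push_cast; rw [Real.rpow_intCast]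
    exact_mod_cast this.symm
  · exact irrational_rpow_ratCast hN (fun n hn => hint ⟨n, hn⟩) ⟨x, hpow.symm⟩

/-- **`log2 x` is irrational for every positive rational `x` that is not an integer power of `2`**; `log2` has
no exact case elsewhere (Lefèvre–Muller, Table 5: "Values of x that are integer powers of 2 are omitted").
[cite: LefevreMuller2001, §5.2 and Table 5] -/
theorem irrational_logb_two_ratCast {x : ℚ} (hx : 0 < x) (hxpow : ∀ k : ℤ, x ≠ 2 ^ k) :
    Irrational (Real.logb 2 x) := by
  simpa using irrational_logb_ratCast padicValRat_two_two (by norm_num) hx (by simpa using hxpow)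

/-- **`log2` has no exact case at a positive rational argument that is not an integer power of 2.**
[cite: LefevreMuller2001, Table 5] -/
theorem log2_no_exact_case {c x : ℚ} (hc : c ≠ 0) (hx : 0 < x) (hxpow : ∀ k : ℤ, x ≠ 2 ^ k) :
    ¬ IsExactCaseDir ((c : ℝ) * Real.logb 2 x) ∧ ¬ IsExactCaseRN ((c : ℝ) * Real.logb 2 x) :=
  no_exact_case_ratCast_mul hc (irrational_logb_two_ratCast hx hxpow)

/-- **`log10 x` is irrational for every positive rational `x` that is not an integer power of `10`.**
[cite: LefevreMuller2001, §5.2 (radix-10 analogue of Table 5)] -/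
theorem irrational_logb_ten_ratCast {x : ℚ} (hx : 0 < x) (hxpow : ∀ k : ℤ, x ≠ 10 ^ k) :
    Irrational (Real.logb 10 x) := by
  simpa using irrational_logb_ratCast padicValRat_two_ten (by norm_num) hx (by simpa using hxpow)

/-- **`log10` has no exact case at a positive rational argument that is not an integer power of 10.**
[cite: LefevreMuller2001, §5.2] -/
theorem log10_no_exact_case {c x : ℚ} (hc : c ≠ 0) (hx : 0 < x) (hxpow : ∀ k : ℤ, x ≠ 10 ^ k) :
    ¬ IsExactCaseDir ((c : ℝ) * Real.logb 10 x) ∧ ¬ IsExactCaseRN ((c : ℝ) * Real.logb 10 x) :=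
  no_exact_case_ratCast_mul hc (irrational_logb_ten_ratCast hx hxpow)

end Literature.ComputerArithmetic.BrisebarreHanrotMullerZimmermann2025
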